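import Summits.ABC.IUTFork.Joshi.HodgeTheatersJoshiGlobalIso
import Summits.ABC.IUTFork.Joshi.HolomorphoidsOfDeformation
import Summits.ABC.IUTFork.Joshi.ArithmeticoidFrobenioids
import Summits.ABC.IUTFork.Joshi.FrobenioidsJoshiRescaling
import HarnessLib

/-!
# [J-III] §10 / §10.11 over the [J-2½] arithmeticoid carrier of record — the merge `ATS2h.DeformationDatum →
# ATS3.ArithmeticoidAbsDatum`, the value ↔ log dictionary with [J-2½] Def. 5.14.2, and what (5.3.3) gives in kernel:
# Prop. 10.3.3 (1)(2) and the GLOBAL half of Thm. 10.11.5.1 DERIVED for any two arithmeticoids of a deformation datum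

Defs-light companion (ONE new definition, the merge map; everything else DERIVED) of `Joshi/HodgeTheatersJoshi.lean` (p433245) and
`Joshi/HodgeTheatersJoshiGlobalIso.lean` (p433294) — abc-iut cell, branch E «type Joshi's construction, test vs S» (rung LADDER-ABC:A2.E),
seat abc-iut-E-t32 (gen 2), plan/E/ASSIGNMENTS.md §4 FALLBACK item 4 «merge-debt reconciliation once the carrier you stubbed has landed»:
p433245's header declared `ArithmeticoidAbsDatum` «the `AbsoluteValue`-valued twin of seat T-37's `ATS2h.DeformationDatum` residue-field data …
merge-debt: a bridge where `|−|_{K_y}` is an absolute value». Sources: [J-III] = K. Joshi, arXiv:2401.13508 **v4** (bib `Joshi2024ATS3`;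
render `HOME/lit/renders/Joshi-arxiv-2401.13508/pNNNN.txt`, «p.N l.M»); [J-2½] = arXiv:2305.10398 (bib `Joshi2023ATS2half`). UNREFEREED
preprints; typed AS CANDIDATES (D-0012): typed ≠ proved ≠ endorsed; no side taken on [IUTchIII] Cor. 3.12 or on any author; no Cor. 3.12
vocabulary (E-PLAN R14). Inputs BY NAME, nothing restated: seat E-t37's `ATS2h.DeformationDatum` with `iota`, `α`, `absLv_eq_rpow` (5.3.3),
`absK_iota_pos` (`Joshi/Arithmeticoids.lean` p430482, `ArithmeticoidPeriods.lean` p430897, `ArithmeticoidProperties.lean` p430871: `valueGroup`,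
`Prop483`); seat E-t5's hypothesis `TriangleValued D` and `absKAbs` (`Joshi/HolomorphoidsOfDeformation.lean` — the one place the Bourbaki
valued fields of [J-2½] §2.3 and Mathlib's `AbsoluteValue` differ, recorded there); seat E-t46's log-coordinate typing of [J-2½] Def. 5.14.2
(`DeformationDatum.divArith`, `logValueGroup`, `Joshi/ArithmeticoidFrobenioids.lean`); seat E-t34's `Frob.exists_degCompatible_iff_exponent_eq_one`
(`Joshi/FrobenioidsJoshiRescaling.lean`); this seat's `Frob.*` (p430621), `ArithmeticoidAbsDatum.*` (p433245), `frobArithR_isIso_of_isEquiv`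
(p433294).

WHAT IS HERE.
1. `ArithmeticoidAbsDatum.ofDeformation D h` — THE MERGE MAP (merge-debt PAID): places `V`, points `|𝒴_{F_v,L_v}|`, residue fields `K_y`,
   `|−|_{K_y}` as an `AbsoluteValue` under `h : TriangleValued D`, embeddings `L → L_v ↪ K_y` (= E-t37's `ι_y`). The induced value
   `|ι_{y_v}(x)|_{K_{y_v}}` AGREES definitionally with E-t37's and with E-t5's `ArithFFDatum.ofDeformation` (`absAt_ofDeformation`,
   `absAt_ofDeformation_eq_arithFF`) — the three typings of the same number coincide.
2. DICTIONARY [J-III] §10.2 value-coordinates ↔ [J-2½] Def. 5.14.2 log-coordinates (seat E-t46): the `v`-component of the principal divisor of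
   `x ∈ L^*` in the CONSTRUCTED `Frob(arith(L)_y)` is `|ι_{y_v}x|`, its logarithm is E-t37's `logCoords y x v = −divArith y x v`
   (`log_frobArith_div_ofDeformation`, `log_frobArith_div_eq_neg_divArith`); `Φ(K_{y_v})^gp = |K_{y_v}^*|` (value form, `Frob.divGroup`) is
   E-t37's `valueGroup` and the exponential of E-t46's `logValueGroup` (`mem_divGroup_ofDeformation_iff`, `mem_divGroup_iff_log_mem_logValueGroup`).
3. WHAT (5.3.3) «`|x|_v = |ι_y(x)|^{α_v(y_v)}_{K_y}`» GIVES IN KERNEL for any two arithmeticoids `y₁`, `y₂` of `D` at a place `v`: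
   `|ι_{y₂}x| = |ι_{y₁}x|^{α_v(y₁)/α_v(y₂)}` on `L` (`absAt_ofDeformation_rpow`) — the DILATATION relation; hence the two induced absolute values are
   EQUIVALENT (`absAt_isEquiv_ofDeformation`), **[J-III] Prop. 10.3.3 (1) holds for them** («abstractly isomorphic Frobenioid structures»,
   `prop1033_1_ofDeformation`), **a degree-compatible isomorphism exists iff `α_v(y₁) = α_v(y₂)`** as soon as `L` has an element of `v`-adic
   absolute value `≠ 1` (Prop. 10.3.3 (2) located in the NORMALISATION COORDINATES of [J-2½] (5.3.5): `exists_degCompatible_ofDeformation_iff`,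
   `prop1033_2_ofDeformation`), and **the GLOBAL half of [J-III] Thm. 10.11.5.1 holds UNCONDITIONALLY over the carrier of record**: the realified
   arithmetic Frobenioids `Frob(arith(L)_{y₁})^ℝ ≅ Frob(arith(L)_{y₂})^ℝ` of ANY two arithmeticoids of `D` are isomorphic
   (`frobArithR_isIso_ofDeformation`; = [J-2½] Prop. 5.15.1's last sentence «many non-isomorphic arithmeticoids of `L` provide isomorphic
   Frobenioids», realified form, DERIVED) — so for every Hodge-theater datum on the `L_mod` side whose realified Frobenioids are this value
   construction, ALL Hodge theaters have isomorphic global constituents (`HodgeTheaterDatum.glob_iso_ofDeformation`), the hypothesis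
   «placewise `IsEquiv`» of p433294 being DISCHARGED by (5.3.3). The LOCAL half (tempered Frobenioids, [André 2003b]) stays Joshi's claim.
4. UNDER E-t37's claim `Prop483` ([J-2½] Prop. 4.8.3 on `𝒴^ℝ_L`: value groups all of `ℝ_{>0}`, residue fields algebraically closed), SUPPLIED
   across the [J-2½] → [J-III] chain: [J-III] Prop. 10.4.1.1 (2)'s hypothesis `Frob.HasRealValueGroup` (`hasRealValueGroup_ofDeformation`),
   `Φ(K_{y_v})^gp = ℝ_{>0}` i.e. «`Frob(arith(L)_y)` equals its realification» ([J-2½] §5.16; `divGroup_ofDeformation_eq_posSubgroup`), and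
   Thm. 10.11.3.1 (3)'s «(perfect)» / Prop. 10.4.1.1 (1) (`isPerfectDiv_ofDeformation`).
LOCATED, no adjudication: over the [J-2½] carrier the valuation-RESCALING between two arithmeticoids is the quotient of normalisation
coordinates `α_v(y₁)/α_v(y₂)`; it is invisible to the elementary Frobenioid up to abstract isomorphism (Prop. 10.3.3 (1)) and to the realified
arithmetic Frobenioid / the Hodge theater's global constituent up to isomorphism (Thm. 10.11.5.1), and visible exactly in the arithmetic DEGREE
(Prop. 10.3.3 (2)) — the same trichotomy the cell's X-06 / X-07′ lines record on our side (E-LOCATION L1), here read on Joshi's own carriers.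
[claim: Joshi2024ATS3, status: disputed]
-/

noncomputable section

namespace Summit.ABC.IUTFork.Joshi.ATS3

open ATS2h

variable {L : Type} [Field L] {V : Type} {Lv : V → Type} [∀ v, Field (Lv v)] {Y : V → Type}
  [∀ v, TopologicalSpace (Y v)] {K : (v : V) → Y v → Type} [∀ v y, Field (K v y)] [∀ v y, TopologicalSpace (K v y)]
  {Gal : V → Type} [∀ v, Group (Gal v)] {Aut : V → Type} [∀ v, Group (Aut v)]
  (D : DeformationDatum L V Lv Y K Gal Aut) (h : TriangleValued D)

namespace ArithmeticoidAbsDatum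

/-! ## 1. The merge map `ATS2h.DeformationDatum → ATS3.ArithmeticoidAbsDatum` -/

/-- **The merge map** (merge-debt of p433245 PAID): the residue-field VALUES of E-t37's deformation datum ([J-2½] Def. 4.1.1 / 5.1.1: for each
place `v` and point `y ∈ |𝒴_{F_v,L_v}|` the residue field `K_y` with `|−|_{K_y}` and `L ⊂ L_v ↪ K_y`) as an `ArithmeticoidAbsDatum` — `|−|_{K_y}`
made a Mathlib `AbsoluteValue` by E-t5's `absKAbs` under `h : TriangleValued D`, the embedding of `L` = E-t37's `ι_y = (L_v ↪ K_y) ∘ (L → L_v)`.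
DERIVED (a definition over E-t37's signature). [claim: Joshi2024ATS3, status: disputed] -/
def ofDeformation : ArithmeticoidAbsDatum L V Y K where
  abs := absKAbs D h
  emb v y := (D.emb v y).comp (D.toLv v)

/-- The absolute values of the merged datum are `|−|_{K_y}`. [folklore] -/
@[simp] theorem ofDeformation_abs_apply (v : V) (y : Y v) (a : K v y) : (ofDeformation D h).abs v y a = D.absK v y a := rfl

/-- The embeddings of the merged datum are E-t37's `ι`. [folklore] -/
theorem ofDeformation_emb_apply (y : D.Arith) (v : V) (x : L) : (ofDeformation D h).emb v (y v) x = D.iota y v x := rfl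

/-- The induced absolute value `|ι_{y_v}(x)|_{K_{y_v}}` on `L` of the merged datum IS E-t37's number ([J-2½] Lem. 5.1.3's `ι_L`). [folklore] -/
theorem absAt_ofDeformation (y : D.Arith) (v : V) (x : L) : (ofDeformation D h).absAt y v x = D.absK v (y v) (D.iota y v x) := rfl

/-- … and IS E-t5's `ArithFFDatum.ofDeformation` reading of the same number: the three typings coincide definitionally. [folklore] -/
theorem absAt_ofDeformation_eq_arithFF (y : D.Arith) (v : V) (x : L) :
    (ofDeformation D h).absAt y v x = (ArithFFDatum.ofDeformation D h).absAt y v x := rfl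

/-- `|ι_{y_v}(x)| > 0` for `x ∈ L^*`. [folklore] -/
theorem absAt_ofDeformation_pos (y : D.Arith) (v : V) (x : Lˣ) : 0 < (ofDeformation D h).absAt y v x := D.absK_iota_pos y v x

/-! ## 2. Dictionary: [J-III] §10.2 value-coordinates = exp of [J-2½] Def. 5.14.2 log-coordinates -/

/-- The `v`-component of the principal divisor of `x ∈ L^*` in the CONSTRUCTED `Frob(arith(L)_y)` over the merged datum is `|ι_{y_v}(x)|_{K_{y_v}}`.
[folklore] -/
theorem val_frobArith_div_ofDeformation (y : D.Arith) (x : Lˣ) (v : V) :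
    ((((ofDeformation D h).frobArith y).div x v : ℝˣ) : ℝ) = D.absK v (y v) (D.iota y v x) := rfl

/-- **Value ↔ log dictionary, principal divisors**: `log` of the [J-III] (10.2.6) divisor coordinate is E-t37's unweighted log vector
`logCoords y x v = log|ι_{y_v}(x)|` ([J-2½] Thm. 5.10.1 (4)). [folklore] -/
theorem log_frobArith_div_ofDeformation (y : D.Arith) (x : Lˣ) (v : V) :
    Real.log ((((ofDeformation D h).frobArith y).div x v : ℝˣ) : ℝ) = D.logCoords y x v := by
  rw [val_frobArith_div_ofDeformation, DeformationDatum.logCoords_apply]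

/-- … equivalently MINUS E-t46's [J-2½] Def. 5.14.2 map `L^* → Φ(arith(L))^gp` in log-coordinates (`divArith = −logCoords`: E-t46's sign
convention «integral = nonnegative»; Joshi's value convention «integral = `≤ 1`»). [folklore] -/
theorem log_frobArith_div_eq_neg_divArith (y : D.Arith) (x : Lˣ) (v : V) :
    Real.log ((((ofDeformation D h).frobArith y).div x v : ℝˣ) : ℝ) = -(D.divArith y x v) := by
  rw [log_frobArith_div_ofDeformation, DeformationDatum.divArith_apply, DeformationDatum.logCoords_apply, neg_neg]

/-- **Value ↔ log dictionary, divisor groups**: the value group `Φ(K_{y_v})^gp = |K_{y_v}^*| ≤ ℝ^×` of [J-III] (10.2.5) (`Frob.divGroup`) is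
E-t37's `valueGroup` ([J-2½] Prop. 4.7.2 (2) / 4.8.3 (2) data). [folklore] -/
theorem mem_divGroup_ofDeformation_iff (y : D.Arith) (v : V) (r : ℝˣ) :
    r ∈ Frob.divGroup ((ofDeformation D h).abs v (y v)) ↔ (r : ℝ) ∈ D.valueGroup v (y v) := by
  constructor
  · rintro ⟨x, rfl⟩
    exact ⟨x, x.ne_zero, rfl⟩
  · rintro ⟨a, ha, har⟩
    exact ⟨Units.mk0 a ha, Units.ext har⟩

/-- … and is the exponential of E-t46's `logValueGroup` ([J-2½] Def. 5.14.2 «`K_v^*/𝒪^*_{K_v}` is the value group of `K_v`» in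
log-coordinates): `r ∈ |K_{y_v}^*| ⟺ r > 0 ∧ log r ∈ log|K_{y_v}^*|`. [folklore] -/
theorem mem_divGroup_iff_log_mem_logValueGroup (y : D.Arith) (v : V) (r : ℝˣ) :
    r ∈ Frob.divGroup ((ofDeformation D h).abs v (y v)) ↔ 0 < (r : ℝ) ∧ Real.log (r : ℝ) ∈ D.logValueGroup y v := by
  constructor
  · rintro ⟨x, rfl⟩
    exact ⟨(absKAbs D h v (y v)).pos x.ne_zero, x, rfl⟩
  · rintro ⟨hr, x, hx⟩
    refine ⟨x, Units.ext ?_⟩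
    have hxpos : 0 < D.absK v (y v) x := (D.absK_isValuedField v (y v)).pos_of_ne_zero x.ne_zero
    exact Real.log_injOn_pos hxpos hr hx

/-! ## 3. What (5.3.3) gives: dilatation, Prop. 10.3.3 (1)(2), and the global half of Thm. 10.11.5.1 — DERIVED -/

/-- [J-2½] (5.3.3) read on `L`: `|x|_v = |ι_{y_v}(x)|^{α_v(y_v)}_{K_{y_v}}` (E-t37's axiom `absLv_eq_rpow`). [folklore] -/
theorem absLv_eq_absAt_rpow (y : D.Arith) (v : V) (x : L) :
    D.absLv v (D.toLv v x) = (ofDeformation D h).absAt y v x ^ D.α v (y v) :=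
  D.absLv_eq_rpow v (y v) (D.toLv v x)

/-- Hence `|ι_{y_v}(x)| = |x|_v^{1/α_v(y_v)}`: the induced absolute value is the `1/α`-th power of the standard one. [folklore] -/
theorem absAt_ofDeformation_eq_rpow_inv (y : D.Arith) (v : V) (x : L) :
    (ofDeformation D h).absAt y v x = D.absLv v (D.toLv v x) ^ (D.α v (y v))⁻¹ := by
  rw [absLv_eq_absAt_rpow D h y v x, Real.rpow_rpow_inv (((ofDeformation D h).absAt y v).nonneg _) (D.α_pos v (y v)).ne']

/-- **The DILATATION relation between two arithmeticoids, DERIVED from (5.3.3)**: at every place `v` and for every `x ∈ L`,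
`|ι_{y₂,v}(x)| = |ι_{y₁,v}(x)|^{α_v(y₁)/α_v(y₂)}` — Prop. 10.3.3 (1)'s hypothesis / [ATS I]'s dilatation (seat E-t1's `IsDilatation` shape)
over the carrier of record, with the exponent READ OFF the normalisation coordinates (5.3.5). [folklore] -/
theorem absAt_ofDeformation_rpow (y₁ y₂ : D.Arith) (v : V) (x : L) :
    (ofDeformation D h).absAt y₂ v x = (ofDeformation D h).absAt y₁ v x ^ (D.α v (y₁ v) / D.α v (y₂ v)) := by
  rw [absAt_ofDeformation_eq_rpow_inv D h y₂, absLv_eq_absAt_rpow D h y₁ v x,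
    ← Real.rpow_mul (((ofDeformation D h).absAt y₁ v).nonneg _), div_eq_mul_inv]

/-- The two absolute values of `L` read in two arithmeticoids are EQUIVALENT (Mathlib `AbsoluteValue.IsEquiv`) at every place — the
hypothesis of p433294's `frobArithR_isIso_of_isEquiv`, DISCHARGED over the carrier of record. [folklore] -/
theorem absAt_isEquiv_ofDeformation (y₁ y₂ : D.Arith) (v : V) :
    ((ofDeformation D h).absAt y₁ v).IsEquiv ((ofDeformation D h).absAt y₂ v) :=
  AbsoluteValue.isEquiv_iff_exists_rpow_eq.2
    ⟨D.α v (y₁ v) / D.α v (y₂ v), div_pos (D.α_pos v (y₁ v)) (D.α_pos v (y₂ v)),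
      funext fun x => (absAt_ofDeformation_rpow D h y₁ y₂ v x).symm⟩

/-- **[J-III] Prop. 10.3.3 (1) DERIVED for any two arithmeticoids of a deformation datum**: the two Frobenioid structures they induce on `L`
at `v` are abstractly isomorphic (this seat's `Frob.prop1033_1_of_isEquiv`). [folklore] -/
theorem prop1033_1_ofDeformation (y₁ y₂ : D.Arith) (v : V) :
    Frob.Prop1033_1 ((ofDeformation D h).absAt y₁ v) ((ofDeformation D h).absAt y₂ v) :=
  Frob.prop1033_1_of_isEquiv (absAt_isEquiv_ofDeformation D h y₁ y₂ v)

/-- If `|x|_v ≠ 1` then `|ι_{y_v}(x)| ≠ 1` (a power of a number `≠ 1`… read backwards: `1^α = 1`). [folklore] -/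
theorem absAt_ofDeformation_ne_one {y : D.Arith} {v : V} {x : L} (hx : D.absLv v (D.toLv v x) ≠ 1) :
    (ofDeformation D h).absAt y v x ≠ 1 := fun h1 => hx (by rw [absLv_eq_absAt_rpow D h y, h1, Real.one_rpow])

/-- **[J-III] Prop. 10.3.3 (2) located in the normalisation coordinates**: at a place `v` where `L` has an element of absolute value `≠ 1`,
a DEGREE-COMPATIBLE isomorphism of the two induced Frobenioid structures exists iff `α_v(y₁) = α_v(y₂)` (seat E-t34's
`exists_degCompatible_iff_exponent_eq_one` at the derived exponent). [folklore] -/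
theorem exists_degCompatible_ofDeformation_iff (y₁ y₂ : D.Arith) (v : V) {x : Lˣ} (hx : D.absLv v (D.toLv v x) ≠ 1) :
    (∃ e : Frob.FrobIso ((ofDeformation D h).absAt y₁ v) ((ofDeformation D h).absAt y₂ v), e.DegCompatible) ↔
      D.α v (y₁ v) = D.α v (y₂ v) := by
  rw [Frob.exists_degCompatible_iff_exponent_eq_one (div_pos (D.α_pos v (y₁ v)) (D.α_pos v (y₂ v)))
    (absAt_ofDeformation_rpow D h y₁ y₂ v) (x := x) (absAt_ofDeformation_ne_one D h hx),
    div_eq_one_iff_eq (D.α_pos v (y₂ v)).ne']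

/-- … so arithmeticoids with DIFFERENT normalisation coordinates at such a place induce Frobenioid structures with NO degree-compatible
isomorphism — this seat's claim-Prop `Frob.Prop1033_2` HOLDS for them (while `Prop1033_1` holds for all pairs): the valuation-rescaling sits in
the arithmetic degree. [folklore] -/
theorem prop1033_2_ofDeformation {y₁ y₂ : D.Arith} {v : V} (hα : D.α v (y₁ v) ≠ D.α v (y₂ v)) {x : Lˣ}
    (hx : D.absLv v (D.toLv v x) ≠ 1) : Frob.Prop1033_2 ((ofDeformation D h).absAt y₁ v) ((ofDeformation D h).absAt y₂ v) :=
  fun he => hα ((exists_degCompatible_ofDeformation_iff D h y₁ y₂ v hx).1 he)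

/-- **The GLOBAL half of [J-III] Thm. 10.11.5.1, UNCONDITIONAL over the carrier of record** (= [J-2½] Prop. 5.15.1's last sentence «many
non-isomorphic arithmeticoids of `L` provide isomorphic Frobenioids», realified form, DERIVED): the value-constructed realified arithmetic
Frobenioids `Frob(arith(L)_{y₁})^ℝ ≅ Frob(arith(L)_{y₂})^ℝ` of ANY two arithmeticoids of a deformation datum are isomorphic elementary
Frobenioids — p433294's placewise signed powers at the exponents `α_v(y₁)/α_v(y₂)`. [folklore] -/
theorem frobArithR_isIso_ofDeformation (y₁ y₂ : D.Arith) :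
    ((ofDeformation D h).frobArithR y₁).IsIso ((ofDeformation D h).frobArithR y₂) :=
  (ofDeformation D h).frobArithR_isIso_of_isEquiv fun v => absAt_isEquiv_ofDeformation D h y₁ y₂ v

/-! ## 4. Under E-t37's claim `Prop483` (𝒴^ℝ_L): real value groups, realification, perfection — SUPPLIED across the chain -/

/-- **[J-III] Prop. 10.4.1.1 (2)'s hypothesis «the value group of `K` is equal to `ℝ`» SUPPLIED** from [J-2½] Prop. 4.8.3 (2) (E-t37's claim
`Prop483`, on `𝒴^ℝ_L`): every positive real is a value `|a|_{K_{y_v}}`. [folklore] -/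
theorem hasRealValueGroup_ofDeformation (h483 : D.Prop483) (hdef : D.IsDef481) (y : D.Arith) (v : V) :
    Frob.HasRealValueGroup ((ofDeformation D h).abs v (y v)) := fun r hr =>
  (mem_divGroup_ofDeformation_iff D h y v r).2 (by rw [(h483 hdef y v).2.2.1]; exact hr)

/-- **[J-2½] §5.16 «`Frob(arith(L)_y)` equals its realification», value form**: under `Prop483` the divisor group `Φ(K_{y_v})^gp = |K_{y_v}^*|`
is ALL of `ℝ_{>0}` (Mathlib `Units.posSubgroup ℝ`). [folklore] -/
theorem divGroup_ofDeformation_eq_posSubgroup (h483 : D.Prop483) (hdef : D.IsDef481) (y : D.Arith) (v : V) :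
    Frob.divGroup ((ofDeformation D h).abs v (y v)) = Units.posSubgroup ℝ := by
  refine le_antisymm ?_ fun r hr => hasRealValueGroup_ofDeformation D h h483 hdef y v r ((Units.mem_posSubgroup r).1 hr)
  rintro r ⟨x, rfl⟩
  exact (Units.mem_posSubgroup _).2 ((absKAbs D h v (y v)).pos x.ne_zero)

/-- **[J-III] Thm. 10.11.3.1 (3) «(perfect)» / Prop. 10.4.1.1 (1) SUPPLIED** under `Prop483` (residue fields `K_{y_v}` algebraically closed):
every local divisor group of the constructed `Frob(arith(L)_y)` is perfect (this seat's `Frob.isPerfectDiv_of_isAlgClosed`). [folklore] -/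
theorem isPerfectDiv_ofDeformation (h483 : D.Prop483) (hdef : D.IsDef481) (y : D.Arith) (v : V) :
    Frob.IsPerfectDiv ((ofDeformation D h).abs v (y v)) := by
  haveI := (h483 hdef y v).2.1
  exact Frob.isPerfectDiv_of_isAlgClosed _

end ArithmeticoidAbsDatum

/-! ## 5. At the level of Hodge theaters à la Joshi (10.11.4.1) -/

namespace HodgeTheaterDatum

variable {M : ModuliDescentDatum} {FT : Type 1} (𝔇 : HodgeTheaterDatum M FT) {Lmod : Type} [Field Lmod] {Lmv : M.Vmod → Type}
  [∀ v, Field (Lmv v)] [∀ v, TopologicalSpace (M.Ymod v)] {Km : (v : M.Vmod) → M.Ymod v → Type} [∀ v y, Field (Km v y)]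
  [∀ v y, TopologicalSpace (Km v y)] {Gm : M.Vmod → Type} [∀ v, Group (Gm v)] {Am : M.Vmod → Type} [∀ v, Group (Am v)]
  (Dm : DeformationDatum Lmod M.Vmod Lmv M.Ymod Km Gm Am) (hm : TriangleValued Dm)

/-- **Thm. 10.11.5.1, GLOBAL half, over the carrier of record**: for a Hodge-theater datum on whose `L_mod` side the realified Frobenioids
`Frob(arith(L_mod)_{y̲})^ℝ` ARE the value construction over a [J-2½] deformation datum `Dm` of `L_mod` (points of `Dm` = the descended
arithmeticoids `𝒴_{L_mod}`), the Hodge theaters of ANY two holomorphoids have ISOMORPHIC global constituents — p433294's `glob_iso_of_isEquiv`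
with its equivalence hypothesis discharged by (5.3.3). The LOCAL constituents remain the claim `HodgeTheatersIsomorphic`. [folklore] -/
theorem glob_iso_ofDeformation (hA : 𝔇.frobArithR = (ArithmeticoidAbsDatum.ofDeformation Dm hm).frobArithR) (h₁ h₂ : 𝔇.Hol) :
    Nonempty ((𝔇.hodgeTheaterOf h₁).glob.Iso (𝔇.hodgeTheaterOf h₂).glob) :=
  𝔇.glob_iso_of_isEquiv _ hA h₁ h₂ fun v =>
    ArithmeticoidAbsDatum.absAt_isEquiv_ofDeformation Dm hm (𝔇.moduliOfHol h₁) (𝔇.moduliOfHol h₂) v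

end HodgeTheaterDatum

end Summit.ABC.IUTFork.Joshi.ATS3

end
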